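import Summits.CriticalPhenomena.PercolationContinuityZ3.Theorems.FK.TwoPointFunctionTailFK
import Literature.Probability.Percolation.LocalEvents
import HarnessLib

/-!
# FK-continuity transplant, FO-08 (f): shift-invariant events are trivial for mixing box limits
# (Grimmett 2006, Thm. (4.19)(d) / Cor. (4.23) ⇒ the `zero_one` hypothesis of Burton–Keane)

Cell `fk-continuity` (bschramm), row FO-08; support file for the FK-continuity transplant
(`--supports stmt-CriticalPhenomena-4575`); builds on p205010 (kernel theorem, internal audit signed;
external expert review pending).

The Burton–Keane hypothesis `IsInsertionTolerantErgodic.zero_one` asks that every measurable event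
invariant under all lattice translations have probability `0` or `1`. For a probability measure on
bond configurations of `ℤ^d`, `d ≥ 1`, which is invariant under translations and **mixing on local
events along `|v| → ∞`** (the conclusion of `IsBoxLimit.tendsto_real_inter_preimage_shift_cofinite`,
`TwoPointFunctionTailFK.lean`, i.e. Grimmett 2006 Cor. (4.23) for `φ^b_{p,q}`), this follows by the
standard approximation argument (as in Aizenman–Duminil-Copin–Sidoravicius 2015, proof of Thm. 2.3
R3, and the tree's `ZeroOneLawMixing.lean`, here along the cofinite filter instead of iterates of one
shift): approximate the invariant event `S` by a local event `B` within `ε` in measure; then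
`P(S) = P(S ∩ τ_v S)` is within `2ε` of `P(B ∩ τ_v B)`, which is eventually within `ε` of
`P(B)² ≈ P(S)²`; hence `P(S) = P(S)²`.

* `measure_eq_zero_or_one_of_tendsto_inter_preimage_shift_cofinite` — the generic statement;
* `IsBoxLimit.measure_eq_zero_or_one_of_forall_preimage_shift_eq` — for box limits `φ^b_{p,q}` with
  the DLR sandwich property (`hG`, row FO-06a `IsBoxLimit.fkGibbs`) and translation invariance
  (`hT`, row FO-06b `IsBoxLimit.measurePreserving_relabel_shift`): Grimmett 2006, Thm. (4.19)(d)
  restricted to translation-invariant events — exactly the `zero_one` field consumed by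
  `UniquenessInfiniteClusterFK.lean`.

## References

* G. Grimmett, *The Random-Cluster Model*, Springer 2006, Thm. (4.19)(d) and Cor. (4.23), pp. 77–79.
  [Grimmett2006]
* M. Aizenman, H. Duminil-Copin, V. Sidoravicius, Comm. Math. Phys. 334 (2015), proof of Thm. 2.3 (R3).
  [AizenmanDuminilCopinSidoraviciusCMP2015]
-/

noncomputable section

open MeasureTheory Set Filter
open scoped ENNReal Topology symmDiff

namespace Summit.CriticalPhenomena.PercolationContinuityZ3.Theorems.FK

open Literature.Probability.Percolation Literature.Probability.LatticeModels

variable {d : ℕ}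

/-- **Mixing along `|v| → ∞` on local events forces translation-invariant events to be trivial**
(the reduction in Aizenman–Duminil-Copin–Sidoravicius 2015, proof of Thm. 2.3 R3; Grimmett 2006,
Cor. (4.23) ⇒ tail/invariant triviality): for a probability measure on bond configurations of `ℤ^d`,
`d ≥ 1`, invariant under translations and with `μ(A ∩ τ_v B) → μ(A)μ(B)` cofinitely for all local
`A, B`, every measurable `S` with `τ_v⁻¹ S = S` for all `v` has `μ(S) ∈ {0,1}`.
[cite: AizenmanDuminilCopinSidoraviciusCMP2015, Thm. 2.3 (proof of R3)] -/
theorem measure_eq_zero_or_one_of_tendsto_inter_preimage_shift_cofinite (hd : 0 < d)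
    (μ : Measure (BondConfig (Site d))) [IsProbabilityMeasure μ]
    (hT : ∀ v : Site d, MeasurePreserving (BondConfig.relabel (sym2Equiv (Site.shift v))) μ μ)
    (hmix : ∀ A B : Set (BondConfig (Site d)), IsLocalEvent A → IsLocalEvent B →
      Tendsto (fun v : Site d => μ.real (A ∩ BondConfig.relabel (sym2Equiv (Site.shift v)) ⁻¹' B))
        cofinite (𝓝 (μ.real A * μ.real B)))
    {S : Set (BondConfig (Site d))} (hS : MeasurableSet S)
    (hSinv : ∀ v : Site d, BondConfig.relabel (sym2Equiv (Site.shift v)) ⁻¹' S = S) :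
    μ S = 0 ∨ μ S = 1 := by
  haveI : Infinite (Site d) := by
    haveI : Nonempty (Fin d) := ⟨⟨0, hd⟩⟩
    exact Pi.infinite_of_right
  -- Step 1: `|μ(S) - μ(S)²| < 5ε` for every `ε > 0`
  have key : ∀ ε : ℝ, 0 < ε → |μ.real S - μ.real S * μ.real S| < 5 * ε := by
    intro ε hε
    obtain ⟨B, hBloc, hBS⟩ := exists_isLocalEvent_measure_symmDiff_lt (μ := μ) hS (ENNReal.ofReal_pos.2 hε)
    have hδ : μ.real (B ∆ S) < ε := by
      rw [measureReal_def]
      exact (ENNReal.toReal_lt_toReal (measure_ne_top μ _) ENNReal.ofReal_ne_top).2 hBS |>.trans_eq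
        (ENNReal.toReal_ofReal hε.le)
    have hBm : MeasurableSet B := measurableSet_of_isLocalEvent_holds hBloc
    have hBSabs : |μ.real B - μ.real S| < ε :=
      (abs_measureReal_sub_le_measureReal_symmDiff hBm.nullMeasurableSet hS.nullMeasurableSet).trans_lt hδ
    -- a far translate at which `B` is almost decorrelated from itself
    obtain ⟨v, hv⟩ := ((Metric.tendsto_nhds.1 (hmix B B hBloc hBloc)) ε hε).exists
    rw [Real.dist_eq] at hv
    set τ := BondConfig.relabel (sym2Equiv (Site.shift v)) with hτ
    -- `μ(S) = μ(S ∩ τ⁻¹ S)` and the translate of `B ∆ S` has the same measure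
    have hSS : μ.real S = μ.real (S ∩ τ ⁻¹' S) := by rw [hSinv v, Set.inter_self]
    have hτsymm : μ.real ((τ ⁻¹' B) ∆ (τ ⁻¹' S)) = μ.real (B ∆ S) := by
      rw [← Set.preimage_symmDiff, measureReal_def, measureReal_def,
        (hT v).measure_preimage (hBm.symmDiff hS).nullMeasurableSet]
    have hdiff : |μ.real (S ∩ τ ⁻¹' S) - μ.real (B ∩ τ ⁻¹' B)| ≤ 2 * μ.real (B ∆ S) := by
      refine (abs_measureReal_sub_le_measureReal_symmDiff (hS.inter (τ.measurable hS)).nullMeasurableSet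
        (hBm.inter (τ.measurable hBm)).nullMeasurableSet).trans ?_
      have hsub : (S ∩ τ ⁻¹' S) ∆ (B ∩ τ ⁻¹' B) ⊆ (B ∆ S) ∪ ((τ ⁻¹' B) ∆ (τ ⁻¹' S)) := by
        intro ω hω
        simp only [Set.mem_symmDiff, Set.mem_inter_iff, Set.mem_union, Set.mem_preimage] at hω ⊢
        tauto
      calc μ.real ((S ∩ τ ⁻¹' S) ∆ (B ∩ τ ⁻¹' B))
          ≤ μ.real (B ∆ S) + μ.real ((τ ⁻¹' B) ∆ (τ ⁻¹' S)) :=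
            (measureReal_mono hsub).trans (measureReal_union_le _ _)
        _ = 2 * μ.real (B ∆ S) := by rw [hτsymm]; ring
    have hB1 : μ.real B ≤ 1 := measureReal_le_one
    have hS1 : μ.real S ≤ 1 := measureReal_le_one
    have hB0 : 0 ≤ μ.real B := measureReal_nonneg
    have hS0 : 0 ≤ μ.real S := measureReal_nonneg
    have hsq : |μ.real B * μ.real B - μ.real S * μ.real S| ≤ 2 * |μ.real B - μ.real S| := by
      rw [show μ.real B * μ.real B - μ.real S * μ.real S =
        (μ.real B - μ.real S) * (μ.real B + μ.real S) by ring, abs_mul]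
      have : |μ.real B + μ.real S| ≤ 2 := by rw [abs_of_nonneg (by positivity)]; linarith
      nlinarith [abs_nonneg (μ.real B - μ.real S)]
    have hBS2 := abs_sub_lt_iff.1 hBSabs
    rw [abs_sub_lt_iff] at hv ⊢
    rw [abs_sub_le_iff] at hdiff hsq
    constructor <;> linarith [hdiff.1, hdiff.2, hsq.1, hsq.2, hBS2.1, hBS2.2]
  -- Step 2: `μ(S) = μ(S)²`, so `μ(S) ∈ {0, 1}`
  have heq : μ.real S - μ.real S * μ.real S = 0 := by
    by_contra hne
    have hpos : 0 < |μ.real S - μ.real S * μ.real S| := abs_pos.2 hne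
    have h := key (|μ.real S - μ.real S * μ.real S| / 5) (by positivity)
    linarith
  have hreal : μ.real S = 0 ∨ μ.real S = 1 := by
    have h : μ.real S * (1 - μ.real S) = 0 := by linarith [heq]
    rcases mul_eq_zero.1 h with h | h
    · exact Or.inl h
    · exact Or.inr (by linarith)
  rcases hreal with h | h
  · exact Or.inl ((measureReal_eq_zero_iff (measure_ne_top μ S)).1 h)
  · right
    rw [measureReal_def] at h
    exact (ENNReal.toReal_eq_one_iff _).1 h

/-- **Grimmett 2006, Thm. (4.19)(d) on translation-invariant events, for box limits**: a box limit
`P = φ^b_{p,q}` (`0 ≤ p ≤ 1`, `q > 0`, `d ≥ 1`) with the DLR sandwich property (`hG`: row FO-06a,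
`IsBoxLimit.fkGibbs`) and translation invariance (`hT`: row FO-06b,
`IsBoxLimit.measurePreserving_relabel_shift`) gives probability `0` or `1` to every measurable event
invariant under all translations — the `zero_one` hypothesis of the tree's Burton–Keane theorem.
[cite: Grimmett2006, Thm. (4.19)(d) with Cor. (4.23), pp. 77–79] -/
theorem IsBoxLimit.measure_eq_zero_or_one_of_forall_preimage_shift_eq {b : Bool} {p q : ℝ}
    {P : Measure (BondConfig (Site d))} (hP : IsBoxLimit d b p q P) (hG : FKGibbs d p q P)
    (hT : ∀ v : Site d, MeasurePreserving (BondConfig.relabel (sym2Equiv (Site.shift v))) P P)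
    (hp : p ∈ Set.Icc (0 : ℝ) 1) (hq : 0 < q) (hd : 0 < d) {S : Set (BondConfig (Site d))}
    (hS : MeasurableSet S)
    (hSinv : ∀ v : Site d, BondConfig.relabel (sym2Equiv (Site.shift v)) ⁻¹' S = S) :
    P S = 0 ∨ P S = 1 := by
  haveI := hP.isProbabilityMeasure
  exact measure_eq_zero_or_one_of_tendsto_inter_preimage_shift_cofinite hd P hT
    (fun A B hA hB => hP.tendsto_real_inter_preimage_shift_cofinite hG hT hp hq hA hB) hS hSinv

end Summit.CriticalPhenomena.PercolationContinuityZ3.Theorems.FK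

end
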